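import Mathlib
import HarnessLib
import HarnessLib.Audit
import Summits.Langlands.Statement
import Literature.FieldTheory.AlgClosed.PadicAlgClEquivComplex
import Literature.NumberTheory.PAdicHodge.FontaineDpst
import Literature.NumberTheory.Automorphic.LocalLanglandsGLProofs
import Literature.NumberTheory.Automorphic.LocalConstantsProofs
import Summits.Langlands.Langlands.Theorems.EisensteinDegreeShiftSectorComplementStubAvatarConjugacy
import HarnessLib.Audit.Status.Attr

/-!
Route: PrimeSwitchSplit

# Route PrimeSwitchSplit — reciprocity for GL(n) = Satake-level existence + Satake-level automorphy
+ compatibility away from l + the p-adic member, glued by reading each place above l through a prime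
below it

Lens `decomposition-first` (LENSES-v3 §3.4) applied to the summit-strength leaf shared by every
Langlands route — "the rest of
the mountain" E = `IrreducibilityBySelfDuality.ReciprocityUpToIrreducibility` (stmt-Langlands-14328;
`Langlands ↔ E ∧ I`, p78886),
which the five ceiling routes reach only through untyped junction cruxes `X_sector → Langlands`. It
suffices to show
X = B_w ∧ W⁺ ∧ P ∧ L∤R (∧ CRD, the summit's own non-vacuity conjunct), typed, pairwise independent
pieces, B_w and W⁺ free
of the reciprocity datum `Rec`, P and L∤R universal in it (rev 4, 2026-08-17: lockstep re-type after
the summit re-type p141787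
`Langlands := ∀ F, Nonempty (ReciprocityData F) ∧ ∀ 𝓡 n, 0 < n → ∀ hcpt, GLC n F 𝓡 hcpt`):
B_w (`WeakGeometricAutomorphy`): every irreducible pinned-geometric ρ : Γ_K → GL_n(ℚ̄_ℓ) is
Satake–Frobenius compatible a.e.
with some L-algebraic cuspidal π (Fontaine–Mazur–Langlands, weak form); W⁺
(`SatakeAvatarExistence`): every L-algebraic cuspidal
π has, for every (ℓ, ι), an IRREDUCIBLE ℓ-adic avatar at Satake level (Buzzard–Gee 3.2.2 weak form +
Ramakrishnan irreducibility);
P (`PadicMemberCompatibility`, the prime-switch principle): for such an avatar ρ and v ∣ ℓ, ρ|_v is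
de Rham and, for EVERY
datum Rec and every ℓ'-adic avatar ρ' of π with ℓ' ∤ v, local–global compatibility of (π, ρ') at v
implies that of (π, ρ) at v
(Fontaine's C_WD for the system: Rec cancels, both sides name rec_v(π_v)); L∤R
(`CompatibilityAwayFromLR`): for EVERY
(Henniart-normalised, canonically pinned) datum Rec, Taylor's Conj. 7 at every v ∤ ℓ for irreducible
pinned-geometric
Satake-compatible pairs (rev 4: the ∃-Rec form L∤ = `CompatibilityAwayFromL`, stmt-Langlands-17417,
is implied by L∤R ∧ CRD —
`compatibilityAwayFromL_existsForm` — and stays with route CompatibleFamilySplit); CRD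
(`CanonicalReciprocityData`, shared support
item stmt-Langlands-17930): `∀ F, Nonempty (ReciprocityData F)`, the summit's non-vacuity conjunct
verbatim. The deciding theorem
`closes : B_w → W⁺ → P → L∤R → CRD → U → Langlands` is PROVED (Sketch.lean rc 0, 0 sorries, std
axioms; U = `AvatarConjugacy`, the
provable-now support item carrying the uniqueness-up-to-conjugacy theorem, cone repair rev 3): above
ℓ each place is read through
ℓ' ∈ {2,3}; and each Sub is certified implied by `Langlands` as re-typed (bc/SubsOfLanglandsR.lean +
the refuters' birth
certificates), so the split is a kernel-checked EQUIVALENCE.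
Lean: `WeakGeometricAutomorphy ∧ SatakeAvatarExistence ∧ PadicMemberCompatibility ∧
CompatibilityAwayFromLR ∧ CanonicalReciprocityData`

## Assembly
`closes (hB : WeakGeometricAutomorphy) (hW : SatakeAvatarExistence) (hP : PadicMemberCompatibility)
(hA : CompatibilityAwayFromLR)
(hR : CanonicalReciprocityData) (hU : AvatarConjugacy) : Langlands` is PROVED in glue.lean (=
Sketch.lean, lean check rc 0, 0 sorries,
std axioms). Fix F; the conjunct `Nonempty (ReciprocityData F)` is `hR F`; fix ANY datum Rec (the
summit's `∀ 𝓡`), n ≥ 1, hcpt.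
Helper: for every irreducible ρ Satake-compatible a.e. with an L-algebraic cuspidal π,
`IsGeometricFramed Rec ρ` (unramified a.e.
from the Satake clause; de Rham above ℓ = P(i)) and `LocalGlobalCompatibleAt Rec ι π ρ v` at every
v: for ℓ ∉ v by L∤R at Rec; for
ℓ ∈ v pick ℓ' ∈ {2,3} with ℓ' ∉ v (one of them misses v since 3 − 2 = 1), ι' : ℚ̄_(ℓ') ≃ ℂ
(`PadicAlgCl.nonempty_ringEquiv_complex`),
ρ' from W⁺ at (ℓ', ι'), `LocalGlobalCompatibleAt Rec ι' π ρ' v` from L∤R (v ∤ ℓ'), and P(ii)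
switches it to
`LocalGlobalCompatibleAt Rec ι π ρ v`
— no Weil–Deligne data is ever destructured (rev 1 cone repair). (A): ρ from W⁺, the helper, and
uniqueness up to
conjugacy by the support item U (`AvatarConjugacy`: two avatars Satake-compatible a.e. with one
cuspidal π, one irreducible, are
conjugate — Chebotarev + Brauer–Nesbitt, Deligne–Serre Lemme 3.2; it IS the landed theorem
`ReciprocityUpToIrreducibility.isConjugate_of_satakeFrobCompatibleAt`, p119850, restated as an item
in rev 3 so that the route file
imports NO Theorems module: that theorem's module cone carries the Langlands–Tunnell / strong-Artin
/ Jacquet–Langlands cluster via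
`def chebotarev_artinRep` in TunnellLemma.lean and JacquetLanglandsParts — refactor request
wi-37501).
(B): π from B_w, then the helper. Every binder is load-bearing.

Rationale: WHY THIS LINE. The summit asks for (A) with local–global compatibility at EVERY finite place and
(B); the tree's own tightness certificates for the
shared leaf E (line `Sketch` of crux 14328: `reciprocityUpToIrreducibility_iff_weak`,
Theorems/*Tightness*.lean) show that E — hence
the summit — is the conjunction of Satake-level existence, Satake-level automorphy and local–global
compatibility, but those pieces
live only as sorried stubs of one parked line, composed through Jacquet–Shalika isobaric rigidity
(AC (2.2)/(2.3) debts), with the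
v ∣ ℓ half stated as a higher-order "∀ Rec, away-body → above-body" clause that is ε-undecidable in
the present tree. This route
promotes the split to route level with three changes that make the glue a theorem of pure structure:
irreducibility is folded into
W⁺ (so Chebotarev–Brauer–Nesbitt, in tree as `isConjugate_of_satakeFrobCompatibleAt`, replaces
Jacquet–Shalika), the p-adic layer
is re-typed Rec-free as Fontaine's C_WD for the automorphic compatible system
(FontaineAsterisque223VIII; the comparison T. Saito
proved geometrically for Hilbert modular forms, arXiv:math/0612077, and Caraiani for Shimura
varieties, arXiv:1202.4683), and the
place above ℓ is read through an auxiliary prime (the classical Carayol–Saito move, here the route's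
patching lemma). Imported
areas: ℓ-independence / p-adic Hodge theory of compatible systems (Sub P), ℓ ≠ p local–global
compatibility (Varma, VarmaFMS2024;
A'Campo–Hevesi–Thorne–Whitmore 2026, arXiv:2607.11763, Conj. 1.1.2–1.1.3 print exactly this layering
and prove the p-adic layer up
to semisimplification for regular π over CM fields). What prior routes do not do: every open
Langlands route either bundles all four
layers into one CM/TR sector statement (LiftDescend.AutToGalCM, NewtonPatching.DirARegularCM,
CMFern) or parks the rest of the
summit in an untyped junction; none files the four layers as separately staffable, separately
killable items with a certified glue,
and none isolates the tree's formal blockers (the Weil–Deligne half of the pinned Fontaine datum,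
the only clause still ε-specified after
D1/(F9) landed on 2026-08-17 ⇒ only P(ii); LocalLanglandsDatum ⇒ only L∤R and CRD) from the two
Rec-free open cores B_w and W⁺.
Negatives index (3 entries) untouched. Rev 4 (route-repair, 2026-08-17): the summit was re-typed `∀
F, Nonempty (ReciprocityData F)
∧ ∀ 𝓡 …` (p141787); L∤ is re-typed in lockstep to the ∀-Rec form L∤R and the non-vacuity conjunct is
attached as the shared
support item CRD (stmt-Langlands-17930) — mathematics unchanged (in print rec_v is unique, Henniart
1993 Thm 1.1, so ∃ Rec and ∀ Rec
say the same thing; in the tree ∀ Rec adds exactly the Henniart-sharpness exposure the summit itself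
now carries).

RANKED CRUXES. #2 WeakGeometricAutomorphy (crux) — B_w — Fontaine–Mazur–Langlands, almost-everywhere
form, for every number field K and n ≥ 1: every irreducible ρ : Γ_K → GL_n(ℚ̄_ℓ) that is unramified
a.e. and de Rham above ℓ (Fontaine's pinned datum) is Satake–Frobenius compatible at almost all
places with some L-algebraic cuspidal π of GL_n(𝔸_K). Verbatim the statement
`weakAutomorphy_of_stubs` of line `Sketch` of crux stmt-Langlands-14328 (there derived from the
Literature text lang.S03). Rec-free. [difficulty: open-problem] (why it might fail: Open core of
(B): automorphy lifting exists only in regular, residually big-image, F totally real/CM regimes (TW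
coincidence, NonRegularWeight, ResiduallyReducible, ShimuraVarietyRealization barriers); irregular
HT weights or mixed-signature F have no engine even for n = 2.) [FontaineMazurGeometric1995,
BuzzardGeeLMS2014, ACCGHLNSTT2023, BarnetlambEtAl2014, Calegari2023, Kisin2009]
#3 SatakeAvatarExistence (crux) — W⁺ — for every number field K, n ≥ 1, every L-algebraic cuspidal π
of GL_n(𝔸_K) and every (ℓ, ι) there is an IRREDUCIBLE ρ : Γ_K → GL_n(ℚ̄_ℓ) Satake–Frobenius
compatible with (π, ι) at almost all places (Buzzard–Gee Conj. 3.2.2 weak form + Ramakrishnan's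
cuspidal ⇒ irreducible; Clozel's Conj. 1.1.1 in arXiv:2607.11763). No de Rham clause, no Rec: ε-free
and Rec-free. [difficulty: open-problem] (why it might fail: No construction of ρ for irregular
L-algebraic π (Maass λ=1/4, non-cohomological weights) or for F neither totally real nor CM (no
Shimura/shtuka realisation); irreducibility is open for n ≥ 3 even for regular π outside polarized /
density-one ι cases.) [BuzzardGeeLMS2014, HarrisLanTaylorThorneRMS2016, Scholze2015, BockleHui2025,
PatrikisTaylor2014, AHTW2026]
#4 PadicMemberCompatibility (crux) — P — the PRIME-SWITCH PRINCIPLE for the p-adic member of the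
automorphic compatible system (rev 1, cone repair: stated over the summit's own predicates): for π
L-algebraic cuspidal, ρ an irreducible ℓ-adic avatar (Satake-compatible a.e.) and v ∣ ℓ, (i) ρ|_v is
de Rham for Fontaine's pinned datum, and (ii) for EVERY reciprocity datum Rec, every prime ℓ' ∤ v,
ι' and every irreducible ℓ'-adic avatar ρ' of (π, ι'), local–global compatibility of (π, ρ') at v
for Rec (read ℓ'-adically, Grothendieck–Deligne) implies local–global compatibility of (π, ρ) at v
for Rec (read through D_pst). Content = Fontaine's C_WD for the system {ρ_(π,ι)} at v (the datum Rec
cancels: both sides name rec_v(π_v)); with L∤ at (π, ι', ρ') it IS Taylor's Conj. 7 at v ∣ ℓ (the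
glue); conversely `Langlands → P` is kernel-certified (bc/SubsOfLanglands.lean: weak-to-strong,
Chebotarev conjugacy, `recGL_eq_of_localGlobalCompatibleAt`). [difficulty: open-problem] (why it
might fail: ℓ = p compatibility for torsion-limit reps is known only up to semisimplification (AHTW
2026 Thm 1.2.1, regular π/CM); N, irregular π, general F open. Formally (i) is decidable since
D1/(F9) (2026-08-17) but WD(D_pst) is pinned only on unramified ρ (F8): (ii)'s ramified sector waits
for D2.) [FontaineAsterisque223VIII, Caraiani2014, BarnetlambEtAl2011, Acampo2023, AHTW2026,
arXiv:math/0612077, arXiv:2407.00288]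
#5 CompatibilityAwayFromLR (crux) — L∤R — Taylor 2004 Conj. 7 at the places v ∤ ℓ, in the `∀ Rec`
form (rev 4): for every number field K and EVERY reciprocity datum Rec (Henniart-normalised local
Langlands data with THE canonical Artin pins — the summit's `∀ 𝓡`), every irreducible
pinned-geometric ρ Satake–Frobenius compatible a.e. with an L-algebraic cuspidal π is
locally–globally compatible with it (Grothendieck–Deligne Weil–Deligne representation ↔ rec_v(π_v),
Frobenius-semisimplified) at every finite v ∤ ℓ. = the ∃-Rec item L∤ (stmt-Langlands-17417, the
registered stub `stub_pairCompatibilityAway` of line `Sketch` of crux 14328) with Rec moved from `∃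
Rec,` to a universal binder after K, nothing else changed; certified implied by the re-typed summit
(`compatibilityAwayFromLR_of_langlands`, bc/SubsOfLanglandsR.lean: direction (A) at Rec + the landed
weak-to-strong upgrade `corresponds_of_exists_corresponds`, p119850); BC7 probe CLEAN. The only crux
mentioning Rec in its conclusion. [difficulty: open-problem] (why it might fail: At ramified v only
the F-semisimplified matching is known for non-polarizable regular π over CM (Varma 2024; N open),
nothing for irregular π / general F; and ∀Rec exposes Henniart-sharpness: a legal ReciprocityData
whose rec_v is off at a ramified generic class refutes it as typed.)
[TaylorGaloisRepresentations2004, HarrisTaylorAMS2001, HenniartInventiones2000, VarmaFMS2024,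
Caraiani2012, CarayolASENS1986, ChenevierHarris2013]
#9 CanonicalReciprocityData (support) — CRD — the summit's NON-VACUITY CONJUNCT verbatim, `∀ F,
Nonempty (ReciprocityData F)` (shared item stmt-Langlands-17930, also wanted by WachComponentCensus
and the SectorComplement redirect; registered birth skeleton `stub_canonicalEpsilonSystem` +
`stub_localLanglands_gl`): at every completion a local Langlands datum for GL_n(F_v) (Harris–Taylor
2001 Thm A; Henniart 2000) normalised against THE local Artin map, with an ε-system canonical at
every finite E/F_v (Deligne 1973 Thm 4.1). Known in print; in the tree it is FACT DEBT — needs-fact: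
`Literature.NumberTheory.Automorphic.localLanglands_gl` (for the pair (canonicalArtin, 𝓔)) and
`Literature.NumberTheory.Automorphic.nonempty_localEpsilonSystem_isCanonical`; the reduction to
exactly these two inputs is LANDED (`ReciprocityUpToIrreducibilityR.stub_nonempty_of_inputs`,
Theorems/…RCanonicalData.lean). Supplies the first conjunct of `closes`. [difficulty: XL fact debt,
provable from the two named facts] [HarrisTaylorAMS2001, HenniartInventiones2000,
Deligne1973Constantes, SerreLocalFields1979]
#9 AvatarConjugacy (support) — U — uniqueness of the irreducible Satake avatar up to
GL_n(ℚ̄_ℓ)-conjugacy: for cuspidal π, ι and framed ℓ-adic ρ₀, ρ both Satake–Frobenius compatible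
with (π, ι) a.e., ρ₀ irreducible ⇒ IsConjugate ρ₀ ρ (uniqueness of Satake parameters + Chebotarev +
Brauer–Nesbitt + irreducibility transfer; Deligne–Serre 1974 Lemme 3.2). Supplies (A)'s uniqueness
clause in `closes`. PROVABLE NOW (3 lines from the landed `isConjugate_of_satakeFrobCompatibleAt`,
p119850) but — cone repair rev 3 — to be closed only by a file whose import cone avoids TunnellLemma
/ StrongArtinGL2 / JacquetLanglandsParts, i.e. after the Literature import-hygiene refactor wi-37501
(thin home for `chebotarev_artinRep`; JacquetLanglandsParts cut out of the Hecke/Satake proof cone);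
otherwise the gate's `_holds` import re-blocks the route. Same substance as
CMFern.CorrespondentUnique (stmt-Langlands-13902), kept separate on purpose. [difficulty:
provable-now] [DeligneSerreASENS1974, SerreAbelianLadic1968, BuzzardGeeLMS2014]

TWO-LAYER PLAN. Foreseen glued splits (each is the BC3 birth skeleton, kernel-checked, to be filed
with `route edit --split` when staffed):
W⁺ ⇐ SemisimpleAvatar (BG 3.2.2 weak, ∃ semisimple ρ; regular TR/CM sector = lang.S27) →
CuspidalAvatarIrreducible (Ramakrishnan:
semisimple + Satake-compatible with cuspidal ⇒ irreducible; = E ∧ JS via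
`isIrreducible_of_weakAutomorphy_allRanks`) → W⁺.
B_w ⇐ RankOne (de Rham characters are algebraic Hecke characters at Satake level; CFT, nearly in
tree via RankOne*.lean) → HigherRank
(n ≥ 2) → B_w; the real regime split foreseen for HigherRank is residually irreducible-adequate
(patching province) vs residually
reducible (Skinner–Wiles / pseudodeformation province), glue = excluded middle on the residual datum
once ModPGaloisRep reduction is
typed for the pinned frame.
L∤R ⇐ GoodPlaces (for EVERY Rec, LGC at places where π, ρ are unramified and Satake-compatible —
essentially the landed wave N4/N6'
`stub_rankN_localGlobalCompatibleAt_of_satakeFrobCompatibleAt`) → BadPlaces (for EVERY Rec: the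
finitely many ramified/exceptional
places — Carayol/Harris–Taylor/Taylor–Yoshida/Varma province; the ∀ Rec costs nothing at generic π_v
once `IsLocalLanglandsGL` is
Henniart-sharp) → L∤R. CRD ⇐ its registered birth skeleton (canonical ε-system fact →
`localLanglands_gl` fact → CRD, glue landed).
P ⇐ DeRhamMember (A'Campo 2023; AHTW 2026 Thm 1.2.1 for regular π over CM) → CrossPrimeClass (C_WD
given de Rham: AHTW up to
semisimplification; the monodromy operator N at p is the open residue, sibling of route
EisensteinMonodromy's N at v ∤ p) → P.

KILL CRITERIA. Each Sub is a KERNEL-CERTIFIED consequence of `Langlands` AS RE-TYPED (∀ 𝓡): B_w, W⁺,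
P by the refuters' birth certificates
against the current summit (`weakGeometricAutomorphy_of_langlands`, Attack.lean of 17414;
`satakeAvatarExistence_of_langlands`, W.lean
of 17415; `padicMemberCompatibility_of_langlands`, PadicMemberCompatibility_attack_probes.lean of
17534 — rc 0, 0 sorries each), L∤R and
CRD by the planner's bc/SubsOfLanglandsR.lean (rev 4, rc 0, 0 sorries, std axioms:
`compatibilityAwayFromLR_of_langlands` via the landed
`corresponds_of_exists_corresponds`, `canonicalReciprocityData_of_langlands` = projection); with
`closes` this makes
`Langlands ↔ B_w ∧ W⁺ ∧ P ∧ L∤R ∧ CRD` a certified equivalence (U is a theorem). Hence a refutation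
of ANY Sub refutes the summit
statement as typed: close `refuted:<Decl>` AND raise a statement audit (a refuted P on the GL₁
instance (|·|^k, χ_cyc^k), k ≠ 0,
would mean the ε-pinned Fontaine datum contradicts the ℓ-adic Weil–Deligne class — AMBER-4 reopens;
a refuted L∤R exhibits a LEGAL,
canonically pinned datum Rec whose rec_v is off ι WD(ρ|_v)^{F-ss} at a ramified generic class — i.e.
`IsLocalLanglandsGL` is not
Henniart-sharp, the ∀𝓡 exposure of statement-audit row B; a refuted CRD means the interface
`LocalLanglandsDatum (F_v)` with both
canonical pins is unsatisfiable as typed — the summit is then FALSE by design, audit at once). If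
instead P's ramified sector is
certified formally undecidable (expected, like `stub_pairCompatibilityAbove`), P parks on
defn-FontainePstWeilDeligneData while B_w,
W⁺, L∤R stay served — the split is built for exactly that. Proved elsewhere moots: E as re-typed
(ReciprocityUpToIrreducibilityR,
17925) closing proves L∤R ∧ CRD and, with JS, W⁺; nothing moots B_w short of the summit.

NOT DECOMPOSED YET. Regular vs irregular weight inside W⁺ and B_w (NonRegularWeightBarrier draws the
line; the regular TR/CM sectors are lang.S27 /
the ten-author theorems and will be filed as supports by whoever staffs the Sub); CM/TR vs general F
(ShimuraVarietyRealization);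
the monodromy operator N versus Frobenius-semisimplified matching inside P and L∤ (AHTW Cor. 1.2.2
`≺`); the n = 1 sector of all four
Subs (closable now from RankOne*.lean / WeakExistenceNormTwist, left to provers with `--supports`);
Hodge–Tate weight recipes (not in
the summit statement).

CHEAPEST FALSIFIER. P(ii) on the trivial GL₁ pair at v ∣ ℓ (π = 1, ρ = 1_ℓ, ρ' = 1_(ℓ'), r' = (1,
0)): it asks the pinned datum to attach to the trivial
representation a Weil–Deligne representation of trivial Frobenius-semisimple class — exactly
`WDTrivialClause`, the disprover's
former separating clause (Disproof §A–§C of crux 14328). RAN AS A LOOKUP: since clause (F8) of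
`IsFontaineDatum` (2026-08-16) it is a
THEOREM under `FontaineDatumExists` (`fontainePstAdicCompletion_isWeilDeligneOf_one_trivial`,
p121983), so the cheapest instance is
consistent. Next cheapest (refuter, this week): P(ii) on (|·|^k, χ_cyc^(−k)), k ≠ 0 — by the c3
notes of crux 14328 this decides a
Frobenius eigenvalue the pinned datum does not fix: expected verdict "formally undecidable, not
false", which pins P's blocked
sector to defn D2 and leaves the other three Subs untouched.

DEFINITION REQUESTS. None new (rev 3: one REFACTOR request, wi-37501 — import hygiene in
Literature/NumberTheory/{GaloisRepresentations,Automorphic}: move `def chebotarev_artinRep` out of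
TunnellLemma.lean to a thin module and cut the edges UnramifiedHeckeLevel /
StrongMultiplicityOneSpherical / AutomorphicRepsGLSatakeFlathProofs → JacquetLanglandsParts; it
gates only the closing of U, nothing else). P inherits the standing definition item
defn-FontainePstWeilDeligneData (D1 `B_dR(K_v)`, D2 `WD ∘ D_pst`, upgrade path of
`Literature/NumberTheory/PAdicHodge/FontaineDpst`); the constructibility of reciprocity data is now
the explicit shared item CRD (17930),
whose two genuinely needed named facts are `localLanglands_gl` and
`nonempty_localEpsilonSystem_isCanonical` (needs-fact; tier-0 debt).
Cite fact available: A'Campo–Hevesi–Thorne–Whitmore 2026 (bib AHTW2026, held as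
paper:arxiv-2607.11763) Thm. 1.2.1 is already
vendored as the Literature named fact
`Literature.NumberTheory.Automorphic.AHTW2026.deRham_hodgeTateRegular` (de Rham clause) — the
regular-CM sector of P(i) can be reshaped onto it by whoever staffs P.

Novelty: Searches (2026-08-17): tree — Cruxes/ReciprocityUpToIrreducibility/{NOTES.md, PICKED.md,
Lines/Sketch.lean, Disproof.lean},
Theorems/*ReciprocityUpToIrreducibility{Tightness,TightnessAbove,CorrespondsConj}*,
NewtonPatching(.WeakToStrong), CMFern glue, all 27
open-route crux lists of the payload, `ledger negatives --problem Langlands` (3, unrelated);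
literature — `lit search --source arxiv
"local-global compatibility l=p"` (6: arXiv:1202.4683, 1105.2240, 1105.2242, 2407.00288 …), `lit
galaxy search "local-global
compatibility" --star all` (28 rows: Weinstein BAMS 2015 survey pdf:-8600971430654097580,
Tilouine–Raghuram volume
panama:350795748868160, Burns–Buzzard LMS 320 panama:260103219445847 …), `lit papers --grep` (held:
paper:arxiv-2607.11763 AHTW 2026,
read pp. 1–7; paper:arxiv-2301.10509); local searchd was DOWN (connection reset) and OpenAlex/arXiv
returned HTTP 429 after the first
query — recorded, not worked around.
Nearest prior art found: (i) in tree, line `Sketch` of crux stmt-Langlands-14328 (stubs W / lang.S03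
⇒ B_w / LGC-away / LGC-above,
composed through Jacquet–Shalika isobaric rigidity; `crux_iff_openStubs`),
AdjointEulerNumerical.Target ((A) ∧ weak (B)),
NewtonPatching.WeakToStrong (proved), CMFern.WeakToStrongGalToAut / CorrespondentUnique; (ii) in
print, A'Campo–Hevesi–Thorne–Whitmore
arXiv:2607.11763 Conj. 1.1.1–1.1.3 / Thm. 1.2.1 (the layering Clozel / v ∤ p / v ∣ p, p-adic layer
up to semisimplification over CM),
Taylor ICM 2002 Conj. 7–8 (TaylorGaloisRe  [refs: 1202.4683, 2607.11763, math/0612077, paper:arxiv-2607.11763, paper:arxiv-2301.10509, TaylorGaloisRepresentations2004]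

Barriers (technique_class: decomposition, compatible-systems, prime-switching): - technique_class: decomposition, compatible-systems, prime-switching
- Literature.Barriers.Langlands.TaylorWilesNumericalCoincidence: not evaded — it is ROUTED: it
threatens only B_w (automorphy lifting at positive defect l₀); W⁺, P, L∤ run no patching. The bet is
that B_w is attacked where the ten-author/Calegari–Geraghty methods live, as its own node.
- Literature.Barriers.Langlands.PatchingLocalComponentBarrier: threatens B_w only (components of
local deformation rings at v ∣ p); P is a statement about representations that already exist and is
attacked by p-adic interpolation / degree shifting (AHTW) or nearby-cycle comparison (Saito),
outside the patching class.
- Literature.Barriers.Langlands.ResiduallyReducibleBarrier: threatens B_w only; the foreseen layer-2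
split of B_w is exactly along it (residually irreducible-adequate vs reducible), so the barrier
becomes a regime boundary, not a wall for the route.
- Literature.Barriers.Langlands.NonRegularWeightBarrier: threatens W⁺ and B_w (cohomological methods
see regular weights only); P and L∤ are conditional on avatars existing and are weight-blind as
statements. It does not evade it; the bet is that isolating the Rec-free cores lets irregular-weight
ideas (CMFern, DegenerateLimits, CapacityClassicality) target W⁺/B_w directly instead of the
monolith.
- Literature.Barriers.Langlands.ShimuraVarietyRealizationBarrier: threatens W⁺ (construction for F
neither TR nor CM); the glue is field-blind and W⁺ is Satake-level only, w

History (route lifecycle, newest last):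
- 2026-08-17T02:00:47Z · rev 1: restated PadicMemberCompatibility (stmt-Langlands-17416) — cone repair (rev 1): P restated as the prime-switch principle over the summit's own predicates (no WeilDeligneRep / recGL binders) and closes no longer destruct (planner-plan-lens3-Langlands-decomp-0)
- 2026-08-17T02:17:14Z · rev 3: restated Assembly (stmt-Langlands-17418) — cone repair (rev 3, route-repair seat, module-cone guardrail): DROP the import Summits…Theorems.IrreducibilityBySelfDualityReciprocityUpToIrreducibilityCorrespo (planner-rrepair-Langlands-PrimeSwitchSplit-b2e718d6-0)
- 2026-08-17T11:22:55Z · rev 4: restated CompatibilityAwayFromL (stmt-Langlands-17417), Assembly (stmt-Langlands-17932) — route-repair (glue, rev 4): summit re-typed `∀ F, Nonempty (ReciprocityData F) ∧ ∀ 𝓡 …` (p141787) broke `closes` at `refine ⟨Rec, …⟩` (file rebuilt after p15400 (planner-rbadge-Langlands-PrimeSwitchSplit-b2e718d6-0)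
- 2026-08-26T06:30:35Z · DORMANT — reconciler: no traction for 8.4 d (last activity statement-closed at 2026-08-17T20:19:34Z); parked, not closed — `ledger route dormant route-Langlands-PrimeSwit (operator:999:97102)
- 2026-08-29T13:28:29Z · REACTIVATED — reconciler: reactivated — activity statement-checked at 2026-08-29T12:28:59Z after parking at 2026-08-26T06:30:35Z (operator:999:1428624)

sub-problem: Langlands · status: open · opened planner-plan-lens3-Langlands-decomp-0 2026-08-17T01:56:24Z · rev 4 · ledger route-Langlands-PrimeSwitchSplit
GENERATED by the gate from the ledger (D-0016/17). Provers cite these decls: `theorem foo : Summit.Langlands.Langlands.Theses.PrimeSwitchSplit.<Decl> := …` in Summits/Langlands/Langlands/Theorems/<Name>.lean.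
-/

namespace Summit.Langlands.Langlands.Theses.PrimeSwitchSplit

open scoped BigOperators Topology Manifold Classical MeasureTheory ProbabilityTheory Matrix InnerProductSpace ComplexConjugate ContinuousMap
open Filter Set Function TopologicalSpace MeasureTheory

attribute [summit_statement] _root_.Langlands

/-- item stmt-Langlands-17414 · crux · rank 2 · open · by planner
why it might fail: Open core of (B): automorphy lifting exists only in regular, residually big-image, F totally real/CM regimes (TW coincidence, NonRegularWeight, ResiduallyReducible, ShimuraVarietyRealization barriers); irregular HT weights or mixed-signature F have no engine even for n = 2.
sources: FontaineMazurGeometric1995, BuzzardGeeLMS2014, ACCGHLNSTT2023, BarnetlambEtAl2014, Calegari2023, Kisin2009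
[crux] B_w — Fontaine–Mazur–Langlands, almost-everywhere form, for every number field K and n ≥ 1:
every irreducible ρ : Γ_K → GL_n(ℚ̄_ℓ) that is unramified a.e. and de Rham above ℓ (Fontaine's
pinned datum) is Satake–Frobenius compatible at almost all places with some L-algebraic cuspidal π
of GL_n(𝔸_K). Verbatim the statement `weakAutomorphy_of_stubs` of line `Sketch` of crux
stmt-Langlands-14328 (there derived from the Literature text lang.S03). Rec-free. [difficulty:
open-problem] -/
@[route_item "route-Langlands-PrimeSwitchSplit", crux]
def WeakGeometricAutomorphy : Prop :=
  ∀ (K : Type) [Field K] [NumberField K] (n : ℕ) (hcpt : Literature.NumberTheory.Automorphic.isCompact_glFiniteIntegralLevel n K), 0 < n → ∀ (ℓ : ℕ) [Fact ℓ.Prime] (ι : PadicAlgCl ℓ ≃+* ℂ) (ρ : Literature.NumberTheory.GaloisRepresentations.FramedGaloisRep K (PadicAlgCl ℓ) n), ρ.toGaloisRep.IsIrreducible → ((∀ᶠ v : IsDedekindDomain.HeightOneSpectrum (NumberField.RingOfIntegers K) in cofinite, ρ.IsUnramifiedAt v) ∧ ∀ (v : IsDedekindDomain.HeightOneSpectrum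 (NumberField.RingOfIntegers K)) (hv : ((ℓ : ℕ) : NumberField.RingOfIntegers K) ∈ v.asIdeal), (Literature.NumberTheory.PAdicHodge.fontainePstAdicCompletion v ℓ hv).IsDeRhamFramed (ρ.toLocal v)) → ∃ π : Literature.NumberTheory.Automorphic.CuspidalAutomorphicRepData n K hcpt, π.1.IsLAlgebraic ∧ ∀ᶠ v : IsDedekindDomain.HeightOneSpectrum (NumberField.RingOfIntegers K) in cofinite, SatakeFrobCompatibleAt ι π.1 ρ v

/-- item stmt-Langlands-17415 · crux · rank 3 · open · by planner
why it might fail: No construction of ρ for irregular L-algebraic π (Maass λ=1/4, non-cohomological weights) or for F neither totally real nor CM (no Shimura/shtuka realisation); irreducibility is open for n ≥ 3 even for regular π outside polarized / density-one ι cases.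
sources: BuzzardGeeLMS2014, HarrisLanTaylorThorneRMS2016, Scholze2015, BockleHui2025, PatrikisTaylor2014, AHTW2026
[crux] W⁺ — for every number field K, n ≥ 1, every L-algebraic cuspidal π of GL_n(𝔸_K) and every (ℓ,
ι) there is an IRREDUCIBLE ρ : Γ_K → GL_n(ℚ̄_ℓ) Satake–Frobenius compatible with (π, ι) at almost
all places (Buzzard–Gee Conj. 3.2.2 weak form + Ramakrishnan's cuspidal ⇒ irreducible; Clozel's
Conj. 1.1.1 in arXiv:2607.11763). No de Rham clause, no Rec: ε-free and Rec-free. [difficulty: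
open-problem] -/
@[route_item "route-Langlands-PrimeSwitchSplit", crux]
def SatakeAvatarExistence : Prop :=
  ∀ (K : Type) [Field K] [NumberField K] (n : ℕ) (hcpt : Literature.NumberTheory.Automorphic.isCompact_glFiniteIntegralLevel n K), 0 < n → ∀ (π : Literature.NumberTheory.Automorphic.CuspidalAutomorphicRepData n K hcpt), π.1.IsLAlgebraic → ∀ (ℓ : ℕ) [Fact ℓ.Prime] (ι : PadicAlgCl ℓ ≃+* ℂ), ∃ ρ : Literature.NumberTheory.GaloisRepresentations.FramedGaloisRep K (PadicAlgCl ℓ) n, ρ.toGaloisRep.IsIrreducible ∧ ∀ᶠ v : IsDedekindDomain.HeightOneSpectrum (NumberField.RingOfIntegers K) in cofinite, SatakeFrobCompatibleAt ι π.1 ρ v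

-- earlier PadicMemberCompatibility (stmt-Langlands-17416, replaced 2026-08-17T02:00:47Z -> stmt-Langlands-17534): retired by None — ∀ (K : Type) [Field K] [NumberField K] (n : ℕ) (hcpt : Literature.NumberTheory.Automorphic.isCompact_glFiniteIntegralLevel n K), 0 < n → ∀ (π : Literature.NumberTheory.Automorphic.CuspidalAutomorphicRepData n K hcpt), π.1.IsLAlgebraic → ∀ (ℓ : ℕ) [Fact ℓ.Prime] (ι : Pad
/-- item stmt-Langlands-17534 · crux · rank 4 · open · by planner
why it might fail: l = p compatibility for torsion-limit reps is known only up to semisimplification (AHTW 2026 Thm 1.2.1, regular pi/CM); N, irregular pi, general F open. Formally (i) is decidable since D1/(F9) (2026-08-17) but WD(D_pst) is pinned only on unramified rho (F8): (ii)'s ramified sector waits for D2.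
sources: FontaineAsterisque223VIII, Caraiani2014, BarnetlambEtAl2011, Acampo2023, AHTW2026, arXiv:math/0612077
[crux] P — the PRIME-SWITCH PRINCIPLE for the p-adic member of the automorphic compatible system
(Rec-parametric, Rec-free in content; rev 1, cone repair: stated over the summit's own predicates
only): for π L-algebraic cuspidal on GL_n/K, ρ an irreducible ℓ-adic avatar of (π, ι)
(Satake–Frobenius compatible a.e.) and a place v ∣ ℓ: (i) ρ|_v is de Rham for Fontaine's pinned
datum; (ii) for EVERY reciprocity datum Rec, every prime ℓ' ∤ v, ι' and every irreducible ℓ'-adic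
avatar ρ' of (π, ι'), local–global compatibility of (π, ρ') at v for Rec (read ℓ'-adically,
Grothendieck–Deligne) implies local–global compatibility of (π, ρ) at v for Rec (read through
D_pst). Mathematically (ii) is Fontaine's C_WD for the system {ρ_(π,ι)}: the
Frobenius-semisimplified Weil–Deligne representation at v of the p-adic member, computed by D_pst,
is the common one of the ℓ'-adic members (Saito arXiv:math/0612077 for Hilbert modular forms;
Caraiani 2012/2014 for Shimura varieties; AHTW 2026 Thm 1.2.1 up to semisimplification for regular π
over CM). Kernel-certified consequence of `Langlands` (bc/SubsOfLanglands.lean); with L∤ at (π, ι',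
ρ') it is Taylor's Conj. 7 at v ∣ ℓ — the glue's patching lemma. -/
@[route_item "route-Langlands-PrimeSwitchSplit", crux]
def PadicMemberCompatibility : Prop :=
  ∀ (K : Type) [Field K] [NumberField K] (n : ℕ) (hcpt : Literature.NumberTheory.Automorphic.isCompact_glFiniteIntegralLevel n K), 0 < n → ∀ (π : Literature.NumberTheory.Automorphic.CuspidalAutomorphicRepData n K hcpt), π.1.IsLAlgebraic → ∀ (ℓ : ℕ) [Fact ℓ.Prime] (ι : PadicAlgCl ℓ ≃+* ℂ) (ρ : Literature.NumberTheory.GaloisRepresentations.FramedGaloisRep K (PadicAlgCl ℓ) n), ρ.toGaloisRep.IsIrreducible → (∀ᶠ v : IsDedekindDomain.HeightOneSpectrum (NumberField.RingOfIntegers K) in cofinite, SatakeFrobCompatibleAt ι π.1 ρ v) → ∀ (v : IsDedekindDomain.HeightOneSpectrum (NumberField.RingOfIntegers K)) (hv : ((ℓ : ℕ) : NumberField.RingOfIntegers K) ∈ v.asIdeal), (Literature.NumberTheory.PAdicHodge.fontainePstAdicCompletion v ℓ hv).IsDeRhamFramed (ρ.toLocal v) ∧ ∀ (Rec : ReciprocityData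 K) (ℓ' : ℕ) [Fact ℓ'.Prime] (ι' : PadicAlgCl ℓ' ≃+* ℂ) (ρ' : Literature.NumberTheory.GaloisRepresentations.FramedGaloisRep K (PadicAlgCl ℓ') n), ((ℓ' : ℕ) : NumberField.RingOfIntegers K) ∉ v.asIdeal → ρ'.toGaloisRep.IsIrreducible → (∀ᶠ w : IsDedekindDomain.HeightOneSpectrum (NumberField.RingOfIntegers K) in cofinite, SatakeFrobCompatibleAt ι' π.1 ρ' w) → LocalGlobalCompatibleAt Rec ι' π.1 ρ' v → LocalGlobalCompatibleAt Rec ι π.1 ρ v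

/-- item stmt-Langlands-18084 · crux · rank 5 · open · by planner
why it might fail: At ramified v only the F-semisimplified matching is known for non-polarizable regular π over CM (Varma 2024; N open), nothing for irregular π / general F; and ∀Rec exposes Henniart-sharpness: a legal ReciprocityData whose rec_v is off at a ramified generic class refutes it as typed.
sources: TaylorGaloisRepresentations2004, HarrisTaylorAMS2001, HenniartInventiones2000, VarmaFMS2024, Caraiani2012, CarayolASENS1986
[crux] L∤R — Taylor 2004 Conj. 7 at the places v ∤ ℓ, in the `∀ Rec` form (rev 4, lockstep re-type
after the summit re-type p141787 `∀ F, Nonempty (ReciprocityData F) ∧ ∀ 𝓡 …`): for every number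
field K and EVERY reciprocity datum Rec (Henniart-normalised local Langlands data with THE canonical
Artin pins — the summit's `∀ 𝓡`), every n ≥ 1 and hcpt, every L-algebraic cuspidal π of GL_n(𝔸_K),
every (ℓ, ι) and every IRREDUCIBLE ρ : Γ_K → GL_n(ℚ̄_ℓ) that is pinned-geometric (unramified a.e.,
de Rham above ℓ for Fontaine's pinned datum) and Satake–Frobenius compatible with (π, ι) a.e.:
`LocalGlobalCompatibleAt Rec ι π ρ v` at every finite v ∤ ℓ (Grothendieck–Deligne Weil–Deligne
representation, Frobenius-semisimplified, ↔ rec_v(π_v)). = item L∤ (stmt-Langlands-17417, ∃-Rec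
form; verbatim the registered stub `stub_pairCompatibilityAway` of line `Sketch` of crux 14328) with
Rec moved from `∃ Rec,` to a universal binder after K and nothing else changed; the ∃-form is
implied back by L∤R ∧ CanonicalReciprocityData (`compatibilityAwayFromL_existsForm`).
Kernel-certified consequence of the re-typed summit (`compatibilityAwayFromLR_of_langlands`, planner
bc/SubsOfLanglandsR.lean: direction (A -/
@[route_item "route-Langlands-PrimeSwitchSplit", crux]
def CompatibilityAwayFromLR : Prop :=
  ∀ (K : Type) [Field K] [NumberField K] (Rec : ReciprocityData K) (n : ℕ) (hcpt : Literature.NumberTheory.Automorphic.isCompact_glFiniteIntegralLevel n K), 0 < n → ∀ (π : Literature.NumberTheory.Automorphic.CuspidalAutomorphicRepData n K hcpt), π.1.IsLAlgebraic → ∀ (ℓ : ℕ) [Fact ℓ.Prime] (ι : PadicAlgCl ℓ ≃+* ℂ) (ρ : Literature.NumberTheory.GaloisRepresentations.FramedGaloisRep K (PadicAlgCl ℓ) n), ρ.toGaloisRep.IsIrreducible → ((∀ᶠ v : IsDedekindDomain.HeightOneSpectrum (NumberField.RingOfIntegers K) in cofinite, ρ.IsUnramifiedAt v) ∧ ∀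 (v : IsDedekindDomain.HeightOneSpectrum (NumberField.RingOfIntegers K)) (hv : ((ℓ : ℕ) : NumberField.RingOfIntegers K) ∈ v.asIdeal), (Literature.NumberTheory.PAdicHodge.fontainePstAdicCompletion v ℓ hv).IsDeRhamFramed (ρ.toLocal v)) → (∀ᶠ v : IsDedekindDomain.HeightOneSpectrum (NumberField.RingOfIntegers K) in cofinite, SatakeFrobCompatibleAt ι π.1 ρ v) → ∀ v : IsDedekindDomain.HeightOneSpectrum (NumberField.RingOfIntegers K), ((ℓ : ℕ) : NumberField.RingOfIntegers K) ∉ v.asIdeal → LocalGlobalCompatibleAt Rec ι π.1 ρ v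

/-- item stmt-Langlands-17844 · support · rank 9 · closed · proved by Summit.Langlands.Langlands.Theorems.EisensteinDegreeShiftSectorComplement.stub_avatarConjugacy @ cddca56775e2 (prover) · by planner
[support] U — UNIQUENESS OF THE IRREDUCIBLE SATAKE AVATAR UP TO CONJUGACY (cone repair rev 2,
2026-08-17): for a cuspidal π of GL_n/K, ι : ℚ̄_ℓ ≃ ℂ and framed ℓ-adic ρ₀, ρ both Satake–Frobenius
compatible with (π, ι) at almost all places, ρ₀ irreducible ⇒ ρ is GL_n(ℚ̄_ℓ)-conjugate to ρ₀
(uniqueness of Satake parameters + Chebotarev density + Brauer–Nesbitt + irreducibility transfer;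
Deligne–Serre 1974 Lemme 3.2). Supplies the uniqueness clause of (A) in `closes`; formerly obtained
inside `closes` from the landed theorem
`Summit.Langlands.Langlands.Theorems.ReciprocityUpToIrreducibility.isConjugate_of_satakeFrobCompatibleAt`
(p119850), whose MODULE CONE drags the Langlands–Tunnell / strong-Artin / Jacquet–Langlands cluster
(47 unproved XL named facts incl. ArtinConjecture) into the route file via
Automorphic/TunnellLemma.lean:204 (`def chebotarev_artinRep`) and JacquetLanglandsParts — which is
what made this route unstaffable. [difficulty: provable-now, 3 lines: `fun K _ _ n hcpt π ℓ _ ι ρ₀ ρ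
h₀ hρ₀ hρ => isConjugate_of_satakeFrobCompatibleAt π.1 ι h₀ hρ₀ hρ`] COORDINATION CONSTRAINT FOR
PROVERS (cone guardrail): do NOT close this item with a Theorems file whose import cone contains -/
@[route_item "route-Langlands-PrimeSwitchSplit", crux]
def AvatarConjugacy : Prop :=
  ∀ (K : Type) [Field K] [NumberField K] (n : ℕ) (hcpt : Literature.NumberTheory.Automorphic.isCompact_glFiniteIntegralLevel n K) (π : Literature.NumberTheory.Automorphic.CuspidalAutomorphicRepData n K hcpt) (ℓ : ℕ) [Fact ℓ.Prime] (ι : PadicAlgCl ℓ ≃+* ℂ) (ρ₀ ρ : Literature.NumberTheory.GaloisRepresentations.FramedGaloisRep K (PadicAlgCl ℓ) n), ρ₀.toGaloisRep.IsIrreducible → (∀ᶠ v : IsDedekindDomain.HeightOneSpectrum (NumberField.RingOfIntegers K) in Filter.cofinite, Summit.Langlands.SatakeFrobCompatibleAt ι π.1 ρ₀ v) → (∀ᶠ v : IsDedekindDomain.HeightOneSpectrum (NumberField.RingOfIntegers K) in Filter.cofinite, Summit.Langlands.SatakeFrobCompatibleAt ι π.1 ρ v) → Summit.Langlands.IsConjugate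 ρ₀ ρ

/-- `AvatarConjugacy` holds: proved by `Summit.Langlands.Langlands.Theorems.EisensteinDegreeShiftSectorComplement.stub_avatarConjugacy` @ cddca56775e2. -/
theorem AvatarConjugacy_holds : AvatarConjugacy := _root_.Summit.Langlands.Langlands.Theorems.EisensteinDegreeShiftSectorComplement.stub_avatarConjugacy

/-- item stmt-Langlands-17930 · support · rank 9 · open · by planner
sources: HarrisTaylorAMS2001, HenniartInventiones2000, Deligne1973Constantes, SerreLocalFields1979
[support] THE SUMMIT'S NON-VACUITY CONJUNCT, verbatim (statement revision p141787, 2026-08-17: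
`Langlands := ∀ F, Nonempty (ReciprocityData F) ∧ ∀ 𝓡 n, 0 < n → ∀ hcpt, GLC n F 𝓡 hcpt`, with
`ReciprocityData` pinned to THE local Artin maps by `llc_isCanonical` / `llc_eps_isCanonical`),
filed by route-repair 5a1bd9af as the explicit INPUT of this route's `∃ RD`-shaped slices
(LiftB2Unram, LiftB2UnramSmallF, LiftB2UnramLargeF, LiftB2UnramSplitP): for every number field F and
every finite place v, a local Langlands datum for GL_n(F_v) (Harris–Taylor 2001 Thm A; Henniart 2000
Thm 1.2) normalised against THE local Artin map `canonicalArtin (F_v)`, whose ε-system (Deligne 1973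
Thm 4.1) is normalised against the canonical Artin map of every finite E/F_v. IN PRINT,
textbook-grade input (Harris–Taylor's Thm A is stated relative to Art_K of local class field
theory); in the TREE not yet derivable — `LocalLanglandsDatum.nonempty` (cite-only) yields a datum
with SOME lawful Artin normalisation, and canonicity needs `IsLocalArtinMap.unique` + the
finite-level reciprocity law for that datum's Artin maps, or canonical variants of
`localLanglands_gl` / `nonempty_localEpsilonSystem` (needs-fact for -/
@[route_item "route-Langlands-PrimeSwitchSplit", crux]
def CanonicalReciprocityData : Prop :=
  ∀ (F : Type) [Field F] [NumberField F], Nonempty (Summit.Langlands.ReciprocityData F)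

-- earlier Assembly (stmt-Langlands-17418, replaced 2026-08-17T02:17:14Z -> stmt-Langlands-17932): retired by None — WeakGeometricAutomorphy → SatakeAvatarExistence → PadicMemberCompatibility → CompatibilityAwayFromL → _root_.Langlands
-- earlier Assembly (stmt-Langlands-17932, replaced 2026-08-17T11:22:55Z -> stmt-Langlands-18085): retired by None — WeakGeometricAutomorphy → SatakeAvatarExistence → PadicMemberCompatibility → CompatibilityAwayFromL → AvatarConjugacy → _root_.Langlands
/-- item stmt-Langlands-18085 · assembly · rank 1 · open · by planner
sources: BuzzardGeeLMS2014, DeligneSerreASENS1974, AHTW2026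
[assembly] WeakGeometricAutomorphy → SatakeAvatarExistence → PadicMemberCompatibility →
CompatibilityAwayFromLR → CanonicalReciprocityData → AvatarConjugacy → Langlands (rev 4,
route-repair after the summit re-type p141787 `Nonempty (ReciprocityData F) ∧ ∀ 𝓡`: L∤ re-typed to
the ∀-Rec form L∤R, the non-vacuity conjunct supplied by the shared support item
CanonicalReciprocityData; proved verbatim by the deciding theorem `closes` in glue.lean —
provable-now by `exact closes`, pure logic, no import beyond this file). -/
@[route_item "route-Langlands-PrimeSwitchSplit"]
def Assembly : Prop :=
  WeakGeometricAutomorphy → SatakeAvatarExistence → PadicMemberCompatibility → CompatibilityAwayFromLR → CanonicalReciprocityData → AvatarConjugacy → _root_.Langlands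

-- records of items no longer active in this route (dropped / restated):
-- earlier CompatibilityAwayFromL (stmt-Langlands-17417, replaced 2026-08-17T11:22:55Z -> stmt-Langlands-18084): open — ∀ (K : Type) [Field K] [NumberField K], ∃ Rec : ReciprocityData K, ∀ (n : ℕ) (hcpt : Literature.NumberTheory.Automorphic.isCompact_glFiniteIntegralLevel n K), 0 < n → ∀ (π : Literature.NumberTheory.Automorphic.CuspidalAutomorphicRepData n K hcpt), π.1.IsLAlgebraic → ∀ (ℓ : ℕ) [Fact 

/-! D-0027 §2.1 — DECIDING THEOREM (planner-authored via `route open/edit --closes-file`; by planner-rbadge-Langlands-PrimeSwitchSplit-b2e718d6-0 2026-08-17T11:22:55Z):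
its hypotheses are this route's items and its conclusion the sub-problem Statement (glue_lint), and it elaborates with this file. -/

@[closes "route-Langlands-PrimeSwitchSplit"] theorem closes (hB : WeakGeometricAutomorphy) (hW : SatakeAvatarExistence)
    (hP : PadicMemberCompatibility) (hA : CompatibilityAwayFromLR) (hR : CanonicalReciprocityData)
    (hU : AvatarConjugacy) : _root_.Langlands := by
  intro F _ _
  -- the summit's non-vacuity conjunct is the shared support item; the correspondence is proved
  -- for EVERY reciprocity datum `Rec` (summit re-type p141787: `Nonempty (ReciprocityData F) ∧ ∀ 𝓡 …`)
  refine ⟨hR F, fun Rec n hn hcpt => ?_⟩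
  have hRec := hA F Rec
  -- every finite place misses the prime 2 or the prime 3
  have hprime : ∀ v : IsDedekindDomain.HeightOneSpectrum (NumberField.RingOfIntegers F),
      ∃ (ℓ' : ℕ) (_ : Fact ℓ'.Prime), ((ℓ' : ℕ) : NumberField.RingOfIntegers F) ∉ v.asIdeal := by
    intro v
    by_cases h2 : ((2 : ℕ) : NumberField.RingOfIntegers F) ∈ v.asIdeal
    · refine ⟨3, ⟨Nat.prime_three⟩, fun h3 => v.isPrime.ne_top ((Ideal.eq_top_iff_one _).2 ?_)⟩
      have h := v.asIdeal.sub_mem h3 h2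
      have h1 : ((3 : ℕ) : NumberField.RingOfIntegers F) - ((2 : ℕ) : NumberField.RingOfIntegers F) = 1 := by
        push_cast; norm_num
      rwa [h1] at h
    · exact ⟨2, ⟨Nat.prime_two⟩, h2⟩
  -- the local–global helper: geometric + compatible at EVERY finite place, for irreducible
  -- Satake–Frobenius compatible pairs; above ℓ the place is read through a prime below it
  have hLGC : ∀ (π : Literature.NumberTheory.Automorphic.CuspidalAutomorphicRepData n F hcpt), π.1.IsLAlgebraic →
      ∀ (ℓ : ℕ) [Fact ℓ.Prime] (ι : PadicAlgCl ℓ ≃+* ℂ)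
        (ρ : Literature.NumberTheory.GaloisRepresentations.FramedGaloisRep F (PadicAlgCl ℓ) n),
        ρ.toGaloisRep.IsIrreducible →
        (∀ᶠ v : IsDedekindDomain.HeightOneSpectrum (NumberField.RingOfIntegers F) in cofinite,
          SatakeFrobCompatibleAt ι π.1 ρ v) →
        IsGeometricFramed Rec ρ ∧
          ∀ v : IsDedekindDomain.HeightOneSpectrum (NumberField.RingOfIntegers F),
            LocalGlobalCompatibleAt Rec ι π.1 ρ v := by
    intro π hL ℓ _ ι ρ hirr hρ
    have hgeo : (∀ᶠ v : IsDedekindDomain.HeightOneSpectrum (NumberField.RingOfIntegers F) in cofinite,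
        ρ.IsUnramifiedAt v) ∧
        ∀ (v : IsDedekindDomain.HeightOneSpectrum (NumberField.RingOfIntegers F))
          (hv : ((ℓ : ℕ) : NumberField.RingOfIntegers F) ∈ v.asIdeal),
          (Literature.NumberTheory.PAdicHodge.fontainePstAdicCompletion v ℓ hv).IsDeRhamFramed
            (ρ.toLocal v) :=
      ⟨hρ.mono fun v ⟨_, _, hur, _⟩ => hur, fun v hv => (hP F n hcpt hn π hL ℓ ι ρ hirr hρ v hv).1⟩
    refine ⟨hgeo, fun v => ?_⟩
    by_cases hv : ((ℓ : ℕ) : NumberField.RingOfIntegers F) ∈ v.asIdeal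
    · obtain ⟨ℓ', _, hℓ'⟩ := hprime v
      obtain ⟨ι'⟩ := PadicAlgCl.nonempty_ringEquiv_complex ℓ'
      obtain ⟨ρ', hirr', hρ'⟩ := hW F n hcpt hn π hL ℓ' ι'
      have hgeo' : (∀ᶠ w : IsDedekindDomain.HeightOneSpectrum (NumberField.RingOfIntegers F) in cofinite,
          ρ'.IsUnramifiedAt w) ∧
          ∀ (w : IsDedekindDomain.HeightOneSpectrum (NumberField.RingOfIntegers F))
            (hw : ((ℓ' : ℕ) : NumberField.RingOfIntegers F) ∈ w.asIdeal),
            (Literature.NumberTheory.PAdicHodge.fontainePstAdicCompletion w ℓ' hw).IsDeRhamFramed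
              (ρ'.toLocal w) :=
        ⟨hρ'.mono fun w ⟨_, _, hur, _⟩ => hur,
          fun w hw => (hP F n hcpt hn π hL ℓ' ι' ρ' hirr' hρ' w hw).1⟩
      -- the prime switch: compatibility with the ℓ'-adic avatar at v, moved to the ℓ-adic one by P(ii)
      exact (hP F n hcpt hn π hL ℓ ι ρ hirr hρ v hv).2 Rec ℓ' ι' ρ' hℓ' hirr' hρ'
        (hRec n hcpt hn π hL ℓ' ι' ρ' hirr' hgeo' hρ' v hℓ')
    · exact hRec n hcpt hn π hL ℓ ι ρ hirr hgeo hρ v hv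
  refine ⟨?_, ?_⟩
  · -- (A) automorphic → Galois, with uniqueness up to conjugacy from the support item
    intro π hL ℓ _ ι
    obtain ⟨ρ, hirr, hρ⟩ := hW F n hcpt hn π hL ℓ ι
    obtain ⟨hgeo, hloc⟩ := hLGC π hL ℓ ι ρ hirr hρ
    exact ⟨ρ, hirr, hgeo, ⟨hρ, hloc⟩, fun ρ' h' => hU F n hcpt π ℓ ι ρ ρ' hirr hρ h'.1⟩
  · -- (B) Galois → automorphic
    intro ℓ _ ι ρ hirr hgeo
    obtain ⟨π, hL, hρ⟩ := hB F n hcpt hn ℓ ι ρ hirr hgeo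
    exact ⟨π, hL, hρ, (hLGC π hL ℓ ι ρ hirr hρ).2⟩

end Summit.Langlands.Langlands.Theses.PrimeSwitchSplit
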